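import Summits.AtomisticToContinuum.HydrodynamicLimit.Theorems.OneFlightGossipEngineEnergyCurrentTailsLevelCensusClosureFrame
import Summits.AtomisticToContinuum.HydrodynamicLimit.Theorems.OneFlightGossipEngineEnergyCurrentTailsLevelCensusClosureAnchors
import Summits.AtomisticToContinuum.HydrodynamicLimit.Theorems.OneFlightGossipEngineEnergyCurrentTailsLevelCensusClosureCore
import Literature.MathematicalPhysics.KineticTheory.HardSphereEulerProofs
import HarnessLib

/-!
# Stub C of the line `level-census-comparison` — THE CENSUS CLOSURE
# (crux `EnergyCurrentTails`, stmt-AtomisticToContinuum-9235)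

`theorem stub_censusClosure : CensusLedger → RateCeiling → MergeCeiling → SplitFloor →
GaussianCensusBound` (registered stub of the line lead's seat c2): the continuous-time comparison
principle `comparison_principle` of `…LevelCensusObjects` instantiated at fixed `N` with
`n r E := (levelCensus … r E).toReal`, the barrier `b(E) = β(N+1)e^{−αE}/E²` (`E₀ = RΔ`,
`α = L/E₀`, `β = m₂e^{L}E₀`, constants from `closure_constants`, all independent of `N`), the
level set `[E₀, Etop(N)]`, the upward Lipschitz bound `closure_hlip`, and the conditional decrease
`closure_hdec` fed by the supersolution inequality `census_supersolution` through the envelope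
`closure_envelope`; the datum anchor is `closure_h0`, levels above `Etop(N)` are covered directly by
the total-energy tail of stub A (`closure_top`).  Output: `n_s(E) ≤ b(E) ≤ (m₂e^{L}/E₀)(N+1)e^{−αE}`
for `N ≥ max(N₁, N₂(Δ), N₃)`, `s ∈ [0,t]`, `E ≥ E₀`.
-/

noncomputable section

open MeasureTheory Set Filter
open scoped ENNReal InnerProductSpace

namespace Summit.AtomisticToContinuum.HydrodynamicLimit.Theorems.EnergyCurrentTailsLevelCensus

open Literature.MathematicalPhysics.KineticTheory Literature.Analysis.FluidPDE

/-- **Stub C — the census closure.**  The crossing ledger and a-priori inputs (A), the collision-rate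
ceiling (F1), the merge/spallation ceiling (F2) and the splitting floor (F3) imply the Gaussian
census bound C⁺ (`GaussianCensusBound`), by the continuous-time comparison principle at fixed `N`
with an exponential barrier anchored on the Chebyshev bound at the base level. -/
theorem stub_censusClosure : CensusLedger → RateCeiling → MergeCeiling → SplitFloor → GaussianCensusBound := by
  intro hLedger hRate hMerge hSplit a₀ θ₀ u₀ ha hθ hu ha0 hθ0
  obtain ⟨σA, hσA, HA⟩ := hLedger a₀ θ₀ u₀ ha hθ hu ha0 hθ0
  obtain ⟨σ1, hσ1, H1⟩ := hRate a₀ θ₀ u₀ ha hθ hu ha0 hθ0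
  obtain ⟨σ2, hσ2, H2⟩ := hMerge a₀ θ₀ u₀ ha hθ hu ha0 hθ0
  obtain ⟨σ3, hσ3, H3⟩ := hSplit a₀ θ₀ u₀ ha hθ hu ha0 hθ0
  refine ⟨min (min (min σA σ1) (min σ2 σ3)) (1 / 2), by positivity, ?_⟩
  intro σ hσ hσlt T ρ θ u hEul Φ hLLN t ht
  have hσm : σ < min (min σA σ1) (min σ2 σ3) := lt_of_lt_of_le hσlt (min_le_left _ _)
  have hσA' : σ < σA := lt_of_lt_of_le hσm ((min_le_left _ _).trans (min_le_left _ _))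
  have hσ1' : σ < σ1 := lt_of_lt_of_le hσm ((min_le_left _ _).trans (min_le_right _ _))
  have hσ2' : σ < σ2 := lt_of_lt_of_le hσm ((min_le_right _ _).trans (min_le_left _ _))
  have hσ3' : σ < σ3 := lt_of_lt_of_le hσm ((min_le_right _ _).trans (min_le_right _ _))
  have hσhalf : σ ≤ 1 / 2 := (lt_of_lt_of_le hσlt (min_le_right _ _)).le
  obtain ⟨hled, ⟨m₂, hm₂, hkin⟩, ⟨α₀, hα₀, K₀, hK₀, htail⟩, hmeas⟩ := HA σ hσ hσA' Φ
  obtain ⟨C₁, hC₁, Eth₁, N₁, HF1⟩ := H1 σ hσ hσ1' T ρ θ u hEul Φ hLLN t ht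
  obtain ⟨A, hA, Δth, hΔth, HF2⟩ := H2 σ hσ hσ2' T ρ θ u hEul Φ hLLN t ht
  obtain ⟨c, hc, Eth₃, N₃, HF3⟩ := H3 σ hσ hσ3' T ρ θ u hEul Φ hLLN t ht
  obtain ⟨L, Δ, R, hL4, hLe, hR8, hRL, hRc, hΔm, hΔA, hΔth', hΔ1, hE1, hE3, hEL, hE4, hEK⟩ :=
    closure_constants m₂ α₀ K₀ Δth Eth₁ Eth₃ hc hC₁ hA
  obtain ⟨N₂, HF2'⟩ := HF2 Δ hΔth'
  -- the barrier constants (independent of `N`)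
  set E₀ : ℝ := R * Δ with hE₀
  set α : ℝ := L / E₀ with hα
  set β : ℝ := m₂ * Real.exp L * E₀ with hβ
  have hΔ0 : 0 < Δ := by linarith
  have hR0 : 0 < (R : ℝ) := by linarith
  have hE₀pos : 0 < E₀ := by positivity
  have hE₀8 : 8 * Δ ≤ E₀ := by rw [hE₀]; exact mul_le_mul_of_nonneg_right hR8 hΔ0.le
  have hL0 : 0 ≤ L := by linarith
  have hαpos : 0 < α := by rw [hα]; exact div_pos (by linarith) hE₀pos
  have hαhalf : α ≤ α₀ / 2 := by
    rw [hα, div_le_iff₀ hE₀pos]; rw [div_le_iff₀ hα₀] at hEL; linarith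
  have hβpos : 0 < β := by positivity
  refine ⟨α, hαpos, m₂ * Real.exp L / E₀, E₀, max N₁ (max N₂ N₃), ?_⟩
  intro N hN s hs E hE
  have hN₁ : N₁ ≤ N := le_trans (le_max_left _ _) hN
  have hN₂ : N₂ ≤ N := le_trans ((le_max_left _ _).trans (le_max_right _ _)) hN
  have hN₃ : N₃ ≤ N := le_trans ((le_max_right _ _).trans (le_max_right _ _)) hN
  -- fixed `N`
  set M : ℝ := (N : ℝ) + 1 with hM
  have hM0 : 0 < M := by rw [hM]; positivity
  have hM1 : 1 ≤ M := by rw [hM]; have := Nat.cast_nonneg (α := ℝ) N; linarith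
  haveI hP : IsProbabilityMeasure (localGibbsLaw σ a₀ u₀ θ₀ N (Φ N)) :=
    isProbabilityMeasure_localGibbsLaw ha hθ hu ha0 hθ0 hσhalf N (Φ N)
  set b : ℝ → ℝ := fun E' => β * M * Real.exp (-(α * E')) / E' ^ 2 with hbdef
  have hb : ∀ E', b E' = β * M * Real.exp (-(α * E')) / E' ^ 2 := fun _ => rfl
  set κ : ℝ := clock σ N with hκ
  have hκ0 : 0 < κ := by rw [hκ, clock]; positivity
  set Etop : ℝ := max E₀ (48 * K₀ ^ (N + 2) / (α₀ ^ 3 * β * M)) with hEtop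
  have hEtop₀ : E₀ ≤ Etop := le_max_left _ _
  have hEtpos : 0 < Etop := lt_of_lt_of_le hE₀pos hEtop₀
  set n : ℝ → ℝ → ℝ := fun r E' => (levelCensus σ a₀ θ₀ u₀ N (Φ N) r E').toReal with hn
  -- a-priori bounds of the census in real form
  have hnM : ∀ r E', n r E' ≤ M := fun r E' => levelCensus_toReal_le (Φ N) r E'
  have hnC : ∀ r, 0 ≤ r → ∀ E', 0 < E' → n r E' ≤ M * m₂ / E' := by
    intro r hr E' hE'
    have h1 := (levelCensus_le_kineticEnergy (a₀ := a₀) (θ₀ := θ₀) (u₀ := u₀) (Φ N) r hE').trans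
      (mul_le_mul' le_rfl (hkin N r hr))
    rw [← ENNReal.ofReal_mul (inv_nonneg.2 hE'.le)] at h1
    have h2 := ENNReal.toReal_mono ENNReal.ofReal_ne_top h1
    rw [ENNReal.toReal_ofReal (by positivity)] at h2
    calc n r E' ≤ E'⁻¹ * (((N : ℝ) + 1) * m₂) := h2
      _ = M * m₂ / E' := by rw [hM]; field_simp
  have hnT : ∀ r, 0 ≤ r → ∀ E', Etop < E' → n r E' ≤ b E' := by
    intro r hr E' hE'
    have h1 := ENNReal.toReal_mono ENNReal.ofReal_ne_top ((htail N E').2 r hr)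
    rw [ENNReal.toReal_ofReal (by positivity)] at h1
    exact h1.trans (closure_top hM0 hβpos hα₀ (by positivity) hE₀pos hαhalf hE'.le)
  have hn0 : ∀ E', E₀ ≤ E' → n 0 E' ≤ b E' := by
    intro E' hE'
    have h1 := ENNReal.toReal_mono ENNReal.ofReal_ne_top (htail N E').1
    rw [ENNReal.toReal_ofReal (by positivity)] at h1
    exact h1.trans (closure_h0 hM0 hm₂ hL0 hα₀ hK₀ hE4 hEK hEL hα hβ hE')
  have hbpos : ∀ E', 0 < E' → 0 < b E' := fun E' hE' => barrier_pos hb hβpos hM0 hE'.ne'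
  -- the final conversion `b E ≤ B (N+1) e^{−αE}` on `[E₀, ∞)`
  have hbB : ∀ E', E₀ ≤ E' → b E' ≤ m₂ * Real.exp L / E₀ * ((N : ℝ) + 1) * Real.exp (-α * E') := by
    intro E' hE'
    have hE'pos : 0 < E' := by linarith
    rw [hb, hβ, div_le_iff₀ (by positivity), neg_mul]
    have h1 : E₀ ^ 2 ≤ E' ^ 2 := pow_le_pow_left₀ hE₀pos.le hE' 2
    have h2 : 0 ≤ m₂ * Real.exp L / E₀ * ((N : ℝ) + 1) * Real.exp (-(α * E')) := by positivity
    calc m₂ * Real.exp L * E₀ * M * Real.exp (-(α * E'))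
        = m₂ * Real.exp L / E₀ * ((N : ℝ) + 1) * Real.exp (-(α * E')) * E₀ ^ 2 := by
          rw [hM]; field_simp
      _ ≤ m₂ * Real.exp L / E₀ * ((N : ℝ) + 1) * Real.exp (-(α * E')) * E' ^ 2 :=
          mul_le_mul_of_nonneg_left h1 h2
  suffices hmain : n s E ≤ b E by
    rw [← ENNReal.ofReal_toReal (levelCensus_ne_top (Φ N) s E)]
    exact ENNReal.ofReal_le_ofReal (hmain.trans (hbB E hE))
  by_cases hEt : E ≤ Etop
  swap
  · exact hnT s hs.1 E (not_le.1 hEt)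
  -- thresholds at levels `E' ≥ E₀`
  have hthr : ∀ E', E₀ ≤ E' → 0 < E' ∧ Δ ≤ E' ∧ 2 * Δ ≤ E' ∧ Eth₁ ≤ E' - Δ ∧ E' - Δ < E' ∧
      E' ≤ 2 * (E' - Δ) ∧ Eth₁ ≤ 4 * E' ∧ Eth₃ ≤ E' := by
    intro E' hE'
    refine ⟨by linarith, by linarith, by linarith, by linarith, by linarith, by linarith, ?_, by linarith⟩
    linarith
  -- the slack `δ₀(N)` and the Lipschitz constant `K(N)`
  set Ttop : ℝ := (⌈Etop / (2 * Δ)⌉₊ : ℝ) + ⌈Etop / Δ⌉₊ + 1 with hTtop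
  have hsqt : 0 < Real.sqrt Etop := Real.sqrt_pos.2 hEtpos
  have hsq₀ : 0 < Real.sqrt E₀ := Real.sqrt_pos.2 hE₀pos
  set Q : ℝ := 2 * C₁ * Real.sqrt Etop + 3 * A * Real.sqrt Etop * (⌈Etop / (2 * Δ)⌉₊ + ⌈Etop / Δ⌉₊ + 1)
    + C₁ * Etop ^ 2 / (2 * E₀ * Real.sqrt E₀) + 2 * c * Real.sqrt Etop with hQ
  have hQ0 : 0 < Q := by
    have h1 : 0 ≤ 2 * C₁ * Real.sqrt Etop + 3 * A * Real.sqrt Etop *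
        (⌈Etop / (2 * Δ)⌉₊ + ⌈Etop / Δ⌉₊ + 1) + C₁ * Etop ^ 2 / (2 * E₀ * Real.sqrt E₀) := by
      positivity
    have h2 : 0 < 2 * c * Real.sqrt Etop := by positivity
    rw [hQ]; linarith
  have hbt0 : 0 < b Etop := hbpos Etop hEtpos
  set δ₀ : ℝ := min M (c / 2 * Real.sqrt E₀ * b Etop / Q) with hδ₀
  have hδ₀pos : 0 < δ₀ := lt_min hM0 (by positivity)
  have hδM : δ₀ ≤ M := min_le_left _ _
  have hδQ : δ₀ * Q ≤ c / 2 * Real.sqrt E₀ * b Etop :=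
    calc δ₀ * Q ≤ c / 2 * Real.sqrt E₀ * b Etop / Q * Q :=
          mul_le_mul_of_nonneg_right (min_le_right _ _) hQ0.le
      _ = c / 2 * Real.sqrt E₀ * b Etop := div_mul_cancel₀ _ hQ0.ne'
  set K : ℝ := κ * (C₁ * Real.sqrt Etop * M + A * Real.sqrt Etop * M * Ttop
    + C₁ * M * m₂ / (2 * Real.sqrt E₀)) with hK
  have hK0 : 0 ≤ K := by positivity
  -- the comparison principle on `[0, t] × [E₀, Etop]`
  refine comparison_principle (n := n) (b := b) (L := Set.Icc E₀ Etop) (t := t) (K := K)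
    (δ₀ := δ₀) hK0 hδ₀pos (fun E' hE' => hn0 E' hE'.1) ?_ ?_ s hs E ⟨hE, hEt⟩
  · -- upward Lipschitz
    intro E' hE' r r' hr hrr' hr't
    obtain ⟨hE'pos, -, h2Δ, hth1, hlt, h2E, hth4, -⟩ := hthr E' hE'.1
    obtain ⟨hsh, htl'⟩ := HF1 N hN₁ r r' hr hrr' hr't
    have hshell := hsh (E' - Δ) E' hth1 hlt h2E
    have htail4 := htl' (4 * E') hth4
    have hmrg := HF2' N hN₂ r r' hr hrr' hr't E' h2Δ
    have hledw := hled N r r' E' hr hrr'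
    refine closure_hlip σ a₀ θ₀ u₀ N (Φ N) C₁ A κ m₂ E' Δ r r' K hP hC₁.le hA.le hκ0.le hm₂.le hrr'
      hE'pos hΔ0 (fun r'' hr'' => hkin N r'' (hr.trans hr''.1)) hshell hmrg htail4 hledw
      (hmeas N r r' _ (measurableSet_mergeEvent _ _)) (hmeas N r r' _ (measurableSet_tailEvent _)) ?_
    -- the crude rate at `E'` is below `K`
    have hs1 : Real.sqrt E' ≤ Real.sqrt Etop := Real.sqrt_le_sqrt hE'.2
    have hs2 : Real.sqrt E₀ ≤ Real.sqrt E' := Real.sqrt_le_sqrt hE'.1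
    have hT : (⌈E' / (2 * Δ)⌉₊ : ℝ) + ⌈E' / Δ⌉₊ + 1 ≤ Ttop := by
      have h1 : (⌈E' / (2 * Δ)⌉₊ : ℝ) ≤ ⌈Etop / (2 * Δ)⌉₊ := by
        exact_mod_cast Nat.ceil_mono (div_le_div_of_nonneg_right hE'.2 (by positivity))
      have h2 : (⌈E' / Δ⌉₊ : ℝ) ≤ ⌈Etop / Δ⌉₊ := by
        exact_mod_cast Nat.ceil_mono (div_le_div_of_nonneg_right hE'.2 hΔ0.le)
      rw [hTtop]; linarith
    have hT0 : (0 : ℝ) ≤ ⌈E' / (2 * Δ)⌉₊ + ⌈E' / Δ⌉₊ + 1 := by positivity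
    have a1 : C₁ * Real.sqrt E' * M ≤ C₁ * Real.sqrt Etop * M :=
      mul_le_mul_of_nonneg_right (mul_le_mul_of_nonneg_left hs1 hC₁.le) hM0.le
    have a2 : A * Real.sqrt E' * M * (⌈E' / (2 * Δ)⌉₊ + ⌈E' / Δ⌉₊ + 1)
        ≤ A * Real.sqrt Etop * M * Ttop := by
      apply mul_le_mul _ hT hT0 (by positivity)
      exact mul_le_mul_of_nonneg_right (mul_le_mul_of_nonneg_left hs1 hA.le) hM0.le
    have a3 : C₁ * M * m₂ / (2 * Real.sqrt E') ≤ C₁ * M * m₂ / (2 * Real.sqrt E₀) :=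
      div_le_div_of_nonneg_left (by positivity) (by positivity) (by linarith)
    rw [hK]
    exact mul_le_mul_of_nonneg_left (by linarith) hκ0.le
  · -- conditional decrease
    intro E' hE' u' r' hu' hur' hr't _ hH1 hH2
    obtain ⟨hE'pos, hΔE, h2Δ, hth1, hlt, h2E, hth4, hth3⟩ := hthr E' hE'.1
    obtain ⟨nhi, h0n, h1n, h2n, h4an, h4bn, hdom⟩ := closure_envelope (n := n) (W := Set.Icc u' r')
      (M := M) (m₂ := m₂) (E₀ := E₀) (Etop := Etop) (δ₀ := δ₀) (b := b) hM0.le hm₂.le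
      (fun E'' h₁ _ => by linarith [hbpos E'' (by linarith)])
      (fun E'' h₁ => (hbpos E'' (by linarith)).le) (fun r _ E'' => hnM r E'')
      (fun r hr E'' hE'' => hnC r (hu'.trans hr.1) E'' hE'')
      (fun r hr E'' h₁ h₂ => hH1 r hr E'' ⟨h₁, h₂⟩)
      (fun r hr E'' hE'' => hnT r (hu'.trans hr.1) E'' hE'')
    obtain ⟨hsh, htl'⟩ := HF1 N hN₁ u' r' hu' hur'.le hr't
    have hshell := hsh (E' - Δ) E' hth1 hlt h2E
    have htail4 := htl' (4 * E') hth4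
    have hmrg := HF2' N hN₂ u' r' hu' hur'.le hr't E' h2Δ
    have hsplit := HF3 N hN₃ u' r' hu' hur'.le hr't E' hth3
    have hledw := hled N u' r' E' hu' hur'.le
    have hsuper := fun K' : ℕ => census_supersolution M c C₁ A m₂ L Δ E₀ α β Etop δ₀ R b nhi hM1
      hc hC₁ hA hm₂ hL4 hLe hR8 hRL hRc hΔm hΔA hE₀ hα hβ hb hEtop₀ hδ₀pos.le hδM hδQ h0n h1n
      h2n h4an h4bn E' (b E' - δ₀) hE'.1 hE'.2 le_rfl K'
    exact closure_hdec σ a₀ θ₀ u₀ N (Φ N) C₁ A c κ E' Δ u' r' (b E' - δ₀) nhi hP hC₁ hA.le hc.le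
      hκ0 hur' hE'pos hΔ0 hΔE h0n hdom hH2 hshell hmrg htail4 hsplit hledw
      (hmeas N u' r' _ (measurableSet_mergeEvent _ _)) (hmeas N u' r' _ (measurableSet_tailEvent _))
      hsuper

end Summit.AtomisticToContinuum.HydrodynamicLimit.Theorems.EnergyCurrentTailsLevelCensus

end
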